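import Summits.CriticalPhenomena.CardyFormulaZ2.Theses.CardyBoundaryCoulombGas
import Literature.Probability.Percolation.QuadCrossingSquareModel
import Literature.Probability.RandomPlanarGeometry.ConformalRectangleProofs
import Literature.Probability.RandomPlanarGeometry.CardyFunctionIncBeta
import Literature.Probability.Percolation.BoxCrossingJordan

/-!
# `RectilinearCardy` (crux stmt-CriticalPhenomena-5660): reductions and why no cheap refutation exists (part 1)

Negative-knowledge / structure lemmas extracted from the standing disprover's work file
`Cruxes/RectilinearCardy/Disproof.lean` (refuter `cdisprove`, 2026-08-16), sorry-free, for ideators,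
planners and provers of the crux to IMPORT. Part 2 (`RectilinearCardySquareInstance.lean`: the square
instance with modulus `1/2`, the Bollobás–Riordan rectangles realising every modulus) builds on
this file.

* §1 `IsRectilinear`, `rectilinearCardy_iff`, `not_cardyFormulaZ2_of_not_rectilinearCardy`: the crux
  is the conjunct `CardyFormulaZ2` restricted to rectilinear Jordan polygons; a refutation of the
  crux refutes Cardy's formula for critical bond percolation on `ℤ²` (Schramm, ICM 2006, Problem
  2.11). (No closed `Prop` abbreviations are declared in this file: the gate relocates those to
  `Literature/` as named facts — bounce p73217/p73218.)
* §2 `modulus R` (the conformal modulus, via the tree's Riemann + Carathéodory theorems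
  `MarkedDomain.exists_isUniformizing_holds`, `ConformalRectangle.crossRatio_eq_of_isUniformizing_holds`),
  `hasCrossingLimit_iff_tendsto / _iff_exists / _iff_modulus`, `rectilinearCardy_iff_modulus`,
  `not_rectilinearCardy_iff`: one uniformizing datum suffices; what a refutation must produce.
* §3 `clusterPt_mem_Ioo`, `limit_mem_Ioo`, `not_frequently_eq_zero / _one`, `cardyFunction_mem_Ioo`,
  `cardyFunction_modulus_mem_Ioo`: every subsequential limit of the crux's crossing probabilities lies
  in `(0,1)` (tree RSW theorem `discreteCrossingProb_clusterPt_mem_Ioo_holds`) and so does the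
  predicted limit, so no junk instance of the typing refutes the crux.
* §4 `isRectilinear_of_carrier_eq`, `isRectilinear_rectQuad`, `rectQuad_pt`,
  `isRectilinear_unitSquareQuad`: rectangles are admissible instances (non-vacuity with genuine
  witnesses); in particular the crux implies the target `RectCardy` of the sibling route
  `CardyMonotoneApproach` (one line, kept in the work file `Cruxes/RectilinearCardy/Disproof.lean`).

References: O. Schramm, Proc. ICM 2006, §2.6 Problem 2.11 [Schramm2007ICM]; B. Bollobás,
O. Riordan, *Percolation* (2006), Ch. 7 §7.1 [BollobasRiordan2006]; J. Cardy, J. Phys. A 25 (1992)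
L201 [CardyJPhysA1992]; G. Grimmett, *Percolation* (1999), §11.7 [GrimmettPercolation1999].
-/

noncomputable section

namespace Summit.CriticalPhenomena.CardyFormulaZ2.Theorems.RectilinearCardy.Negative

open Set Filter Topology Complex
open UpperHalfPlane (upperHalfPlaneSet)
open Literature.Probability.RandomPlanarGeometry
open Literature.Probability.Percolation (bondDomainCrossingProb discreteCrossingProb half unitSquareQuad
  rectQuad rectQuad_carrier unitSquareQuad_carrier discreteCrossingProb_clusterPt_mem_Ioo_holds
  mem_segment_iff_of_im_eq mem_segment_iff_of_re_eq mem_rectQuad_arc_zero mem_rectQuad_arc_one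
  mem_rectQuad_arc_two mem_rectQuad_arc_three)
open Summit.CriticalPhenomena.CardyFormulaZ2.Theses.CardyBoundaryCoulombGas (RectilinearCardy)

/-! ## §1 The crux, unfolded; the crux is the conjunct restricted to rectilinear polygons -/

/-- The hypothesis of the crux: the Jordan boundary of `R` lies in finitely many axis-parallel
(possibly degenerate) segments, i.e. `R` is a rectilinear Jordan polygon. [folklore] -/
def IsRectilinear (R : ConformalRectangle) : Prop :=
  ∃ S : Finset (ℂ × ℂ), (∀ p ∈ S, p.1.re = p.2.re ∨ p.1.im = p.2.im) ∧
    frontier R.carrier ⊆ ⋃ p ∈ S, segment ℝ p.1 p.2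

/-- `RectilinearCardy` is, by `rfl`, Cardy's formula for bond-`ℤ²` restricted to rectilinear
conformal rectangles. [folklore] -/
theorem rectilinearCardy_iff :
    RectilinearCardy ↔ ∀ R : ConformalRectangle, IsRectilinear R →
      R.HasCrossingLimit (bondDomainCrossingProb R) cardyFunction :=
  Iff.rfl

/-- **The crux is weaker than the conjunct**: `RectilinearCardy` is `CardyFormulaZ2` restricted to
rectilinear conformal rectangles, so `¬ RectilinearCardy → ¬ CardyFormulaZ2` — any refutation of
the crux refutes Cardy's formula for critical bond percolation on `ℤ²` (Schramm, ICM 2006,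
Problem 2.11: open, believed true), and any proof of the crux that never uses rectilinearity proves
the conjunct outright. (Stated negatively on purpose: the positive form `CardyFormulaZ2 →
RectilinearCardy`, `fun h R _ ↦ h R`, would read as a conditional proof of the item.) [folklore] -/
theorem not_cardyFormulaZ2_of_not_rectilinearCardy (h : ¬ RectilinearCardy) : ¬ _root_.CardyFormulaZ2 :=
  fun h' ↦ h fun R _ ↦ h' R

/-! ## §2 One uniformizing datum suffices: what a refutation must produce -/

/-- **Single-datum form of `HasCrossingLimit`.** Given ONE uniformizing datum `(φ, x)` of `R`,
`R.HasCrossingLimit p F ↔ p δ → F (crossRatio x)` (`δ → 0⁺`): the universal quantifier over data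
in the combinator is harmless because the cross-ratio is datum-independent
(`ConformalRectangle.crossRatio_eq_of_isUniformizing_holds`, proved in the tree from Carathéodory).
[folklore] -/
theorem hasCrossingLimit_iff_tendsto {R : ConformalRectangle}
    {φ : ConformalEquiv upperHalfPlaneSet R.carrier} {x : Fin 4 → ℝ} (h : R.IsUniformizing φ x)
    {p F : ℝ → ℝ} :
    R.HasCrossingLimit p F ↔ Tendsto p (𝓝[>] 0) (𝓝 (F (crossRatio x))) := by
  constructor
  · intro H
    exact H φ x h
  · intro H φ' x' h'
    rw [ConformalRectangle.crossRatio_eq_of_isUniformizing_holds h' h]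
    exact H

/-- **Existential form**: `R.HasCrossingLimit p F ↔ ∃ datum (φ, x), p → F (crossRatio x)`
(data exist by `MarkedDomain.exists_isUniformizing_holds`: Riemann mapping + Carathéodory, both
theorems of the tree). In particular `HasCrossingLimit` is never vacuously true. [folklore] -/
theorem hasCrossingLimit_iff_exists {R : ConformalRectangle} {p F : ℝ → ℝ} :
    R.HasCrossingLimit p F ↔ ∃ (φ : ConformalEquiv upperHalfPlaneSet R.carrier) (x : Fin 4 → ℝ),
      R.IsUniformizing φ x ∧ Tendsto p (𝓝[>] 0) (𝓝 (F (crossRatio x))) := by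
  constructor
  · intro H
    obtain ⟨φ, x, h⟩ := MarkedDomain.exists_isUniformizing_holds R
    exact ⟨φ, x, h, H φ x h⟩
  · rintro ⟨φ, x, h, H⟩
    exact (hasCrossingLimit_iff_tendsto h).2 H

/-- The **conformal modulus** `η_R ∈ (0,1)` of a conformal rectangle: the cross-ratio of a chosen
uniformizing datum (well defined by `crossRatio_eq_of_isUniformizing_holds`). [folklore] -/
def modulus (R : ConformalRectangle) : ℝ :=
  crossRatio (Classical.choose (Classical.choose_spec (MarkedDomain.exists_isUniformizing_holds R)))

/-- The chosen datum behind `modulus R` is uniformizing. [folklore] -/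
theorem isUniformizing_modulusDatum (R : ConformalRectangle) :
    R.IsUniformizing (Classical.choose (MarkedDomain.exists_isUniformizing_holds R))
      (Classical.choose (Classical.choose_spec (MarkedDomain.exists_isUniformizing_holds R))) :=
  Classical.choose_spec (Classical.choose_spec (MarkedDomain.exists_isUniformizing_holds R))

/-- `modulus R` is the cross-ratio of EVERY uniformizing datum of `R`. [folklore] -/
theorem crossRatio_eq_modulus {R : ConformalRectangle}
    {φ : ConformalEquiv upperHalfPlaneSet R.carrier} {x : Fin 4 → ℝ} (h : R.IsUniformizing φ x) :
    crossRatio x = modulus R :=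
  ConformalRectangle.crossRatio_eq_of_isUniformizing_holds h (isUniformizing_modulusDatum R)

/-- The modulus lies in `(0,1)`. [folklore] -/
theorem modulus_mem_Ioo (R : ConformalRectangle) : modulus R ∈ Ioo 0 1 :=
  ConformalRectangle.crossRatio_mem_Ioo_of_isUniformizing (isUniformizing_modulusDatum R)

/-- `HasCrossingLimit` without quantifiers: `p δ → F (modulus R)`. [folklore] -/
theorem hasCrossingLimit_iff_modulus {R : ConformalRectangle} {p F : ℝ → ℝ} :
    R.HasCrossingLimit p F ↔ Tendsto p (𝓝[>] 0) (𝓝 (F (modulus R))) := by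
  rw [hasCrossingLimit_iff_tendsto (isUniformizing_modulusDatum R)]
  rfl

/-- **The crux without the conformal-map quantifiers**: for every rectilinear conformal rectangle,
`bondDomainCrossingProb R δ → cardyFunction (modulus R)` as `δ → 0⁺`. [folklore] -/
theorem rectilinearCardy_iff_modulus :
    RectilinearCardy ↔ ∀ R : ConformalRectangle, IsRectilinear R →
      Tendsto (bondDomainCrossingProb R) (𝓝[>] 0) (𝓝 (cardyFunction (modulus R))) := by
  simp only [rectilinearCardy_iff, hasCrossingLimit_iff_modulus]

/-- **What a refutation must produce**: a rectilinear `R`, a uniformizing datum `(φ, x)` (or any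
identification of `modulus R`), and a proof that the crossing probabilities do NOT tend to
`F(crossRatio x)`. [folklore] -/
theorem not_rectilinearCardy_iff :
    ¬ RectilinearCardy ↔ ∃ R : ConformalRectangle, IsRectilinear R ∧
      ∃ (φ : ConformalEquiv upperHalfPlaneSet R.carrier) (x : Fin 4 → ℝ), R.IsUniformizing φ x ∧
        ¬ Tendsto (bondDomainCrossingProb R) (𝓝[>] 0) (𝓝 (cardyFunction (crossRatio x))) := by
  rw [rectilinearCardy_iff]
  push Not
  refine exists_congr fun R ↦ and_congr_right fun _ ↦ ?_
  constructor
  · intro H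
    obtain ⟨φ, x, h⟩ := MarkedDomain.exists_isUniformizing_holds R
    exact ⟨φ, x, h, fun H' ↦ H ((hasCrossingLimit_iff_tendsto h).2 H')⟩
  · rintro ⟨φ, x, h, H⟩ H'
    exact H (H' φ x h)

/-! ## §3 No junk refutation: every subsequential limit lies in `(0,1)` (tree RSW theorem) -/

/-- **RSW non-degeneracy for the crux's own discretisation** (tree theorem
`discreteCrossingProb_clusterPt_mem_Ioo_holds`: RSW at `p = 1/2`, FKG/duality chaining near the arcs,
bulk property of the largest-component discretisation for every Jordan domain): every cluster point
at `0⁺` of `δ ↦ bondDomainCrossingProb R δ` lies in `(0,1)`, for EVERY conformal rectangle `R`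
(rectilinear or not). This kills all "junk" attacks on the typing (empty or overlapping discrete
arcs, disconnected mesh domains, marks at corners, sides on lattice lines): they can only affect
finitely many... no: only meshes `δ` bounded away from `0`. [folklore] -/
theorem clusterPt_mem_Ioo (R : ConformalRectangle) {c : ℝ}
    (hc : MapClusterPt c (𝓝[>] 0) (bondDomainCrossingProb R)) : c ∈ Ioo 0 1 :=
  discreteCrossingProb_clusterPt_mem_Ioo_holds R hc

/-- If the crossing probabilities of `R` converge at all, the limit lies in `(0,1)`. [folklore] -/
theorem limit_mem_Ioo (R : ConformalRectangle) {c : ℝ}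
    (h : Tendsto (bondDomainCrossingProb R) (𝓝[>] 0) (𝓝 c)) : c ∈ Ioo 0 1 :=
  clusterPt_mem_Ioo R (ClusterPt.of_le_nhds h)

/-- No conformal rectangle has crossing probability `0` for arbitrarily small meshes (the
degenerate-arc attack; cf. `CardyUniqueLimitNegDegenerateArcs_refuted`). [folklore] -/
theorem not_frequently_eq_zero (R : ConformalRectangle) :
    ¬ ∃ᶠ δ in 𝓝[>] 0, bondDomainCrossingProb R δ = 0 := by
  intro hR
  have h0 : MapClusterPt (0 : ℝ) (𝓝[>] (0 : ℝ)) (bondDomainCrossingProb R) := by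
    rw [mapClusterPt_iff_frequently]
    intro s hs
    exact hR.mono fun δ hδ ↦ by rw [hδ]; exact mem_of_mem_nhds hs
  exact lt_irrefl (0 : ℝ) (clusterPt_mem_Ioo R h0).1

/-- No conformal rectangle has crossing probability `1` for arbitrarily small meshes (the
sure-crossing attack: a mesh vertex lying in BOTH discrete arcs makes the event sure, since
`Reachable` is reflexive; this needs `dist(arc 0, arc 2) ≤ 2δ`, impossible for small `δ`). [folklore] -/
theorem not_frequently_eq_one (R : ConformalRectangle) :
    ¬ ∃ᶠ δ in 𝓝[>] 0, bondDomainCrossingProb R δ = 1 := by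
  intro hR
  have h1 : MapClusterPt (1 : ℝ) (𝓝[>] (0 : ℝ)) (bondDomainCrossingProb R) := by
    rw [mapClusterPt_iff_frequently]
    intro s hs
    exact hR.mono fun δ hδ ↦ by rw [hδ]; exact mem_of_mem_nhds hs
  exact lt_irrefl (1 : ℝ) (clusterPt_mem_Ioo R h1).2

/-- Cardy's function maps `(0,1)` into `(0,1)` (strictly increasing on `[0,1]`, `F 0 = 0`,
`F 1 = 1`, all proved in the tree), so the predicted limit `F(η_R)` is itself an admissible cluster
point: §3 gives no contradiction with the crux, only with its junk instances. [folklore] -/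
theorem cardyFunction_mem_Ioo {η : ℝ} (hη : η ∈ Ioo (0 : ℝ) 1) : cardyFunction η ∈ Ioo (0 : ℝ) 1 := by
  have hmono := strictMonoOn_cardyFunction_holds
  have h0 : (0 : ℝ) ∈ Icc (0 : ℝ) 1 := ⟨le_rfl, zero_le_one⟩
  have h1 : (1 : ℝ) ∈ Icc (0 : ℝ) 1 := ⟨zero_le_one, le_rfl⟩
  have hη' : η ∈ Icc (0 : ℝ) 1 := ⟨hη.1.le, hη.2.le⟩
  constructor
  · have := hmono h0 hη' hη.1
    rwa [cardyFunction_zero] at this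
  · have := hmono hη' h1 hη.2
    rwa [show cardyFunction 1 = 1 from cardyFunction_one_holds] at this

/-- The predicted limit of the crux is always an interior value. [folklore] -/
theorem cardyFunction_modulus_mem_Ioo (R : ConformalRectangle) :
    cardyFunction (modulus R) ∈ Ioo (0 : ℝ) 1 :=
  cardyFunction_mem_Ioo (modulus_mem_Ioo R)

/-! ## §4 Rectangles are admissible; the square test instance (the cheapest kill shot, and why it misses) -/

section Rectangles
open scoped Classical

variable {x₀ x₁ y₀ y₁ : ℝ} (hx : x₀ < x₁) (hy : y₀ < y₁)

include hx hy in
/-- **Every conformal rectangle whose carrier is an open axis-parallel rectangle satisfies the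
hypothesis of the crux** (its frontier is the union of the four closed sides), whatever its marks.
Non-vacuity of `RectilinearCardy` with genuine witnesses, and the bridge to the rectangle items of
the sibling routes (`CardyMonotoneApproach.RectCardy`, `CardyHausdorffMoment`, `CardyLogModulus`). [folklore] -/
theorem isRectilinear_of_carrier_eq {R : ConformalRectangle}
    (hR : R.carrier = Ioo x₀ x₁ ×ℂ Ioo y₀ y₁) : IsRectilinear R := by
  refine ⟨{(⟨x₀, y₀⟩, ⟨x₁, y₀⟩), (⟨x₀, y₁⟩, ⟨x₁, y₁⟩), (⟨x₀, y₀⟩, ⟨x₀, y₁⟩), (⟨x₁, y₀⟩, ⟨x₁, y₁⟩)}, ?_, ?_⟩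
  · intro p hp
    simp only [Finset.mem_insert, Finset.mem_singleton] at hp
    rcases hp with rfl | rfl | rfl | rfl <;> simp
  · intro z hz
    rw [hR, Complex.frontier_reProdIm, closure_Ioo hx.ne, frontier_Ioo hy,
      closure_Ioo hy.ne, frontier_Ioo hx] at hz
    simp only [mem_iUnion, Finset.mem_insert, Finset.mem_singleton, exists_prop]
    rcases hz with ⟨hre, him⟩ | ⟨hre, him⟩
    · rcases him with him | him
      · refine ⟨(⟨x₀, y₀⟩, ⟨x₁, y₀⟩), Or.inl rfl, ?_⟩
        show z ∈ segment ℝ (⟨x₀, y₀⟩ : ℂ) ⟨x₁, y₀⟩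
        rw [mem_segment_iff_of_im_eq (p := ⟨x₀, y₀⟩) (q := ⟨x₁, y₀⟩) hx.le rfl]
        exact ⟨by simpa using him, by simpa using hre⟩
      · refine ⟨(⟨x₀, y₁⟩, ⟨x₁, y₁⟩), Or.inr (Or.inl rfl), ?_⟩
        show z ∈ segment ℝ (⟨x₀, y₁⟩ : ℂ) ⟨x₁, y₁⟩
        rw [mem_segment_iff_of_im_eq (p := ⟨x₀, y₁⟩) (q := ⟨x₁, y₁⟩) hx.le rfl]
        exact ⟨by simpa using him, by simpa using hre⟩
    · rcases hre with hre | hre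
      · refine ⟨(⟨x₀, y₀⟩, ⟨x₀, y₁⟩), Or.inr (Or.inr (Or.inl rfl)), ?_⟩
        show z ∈ segment ℝ (⟨x₀, y₀⟩ : ℂ) ⟨x₀, y₁⟩
        rw [mem_segment_iff_of_re_eq (p := ⟨x₀, y₀⟩) (q := ⟨x₀, y₁⟩) hy.le rfl]
        exact ⟨by simpa using hre, by simpa using him⟩
      · refine ⟨(⟨x₁, y₀⟩, ⟨x₁, y₁⟩), Or.inr (Or.inr (Or.inr rfl)), ?_⟩
        show z ∈ segment ℝ (⟨x₁, y₀⟩ : ℂ) ⟨x₁, y₁⟩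
        rw [mem_segment_iff_of_re_eq (p := ⟨x₁, y₀⟩) (q := ⟨x₁, y₁⟩) hy.le rfl]
        exact ⟨by simpa using hre, by simpa using him⟩

/-- Every model rectangle `rectQuad x₀ x₁ y₀ y₁` (corners marked counterclockwise from the
bottom-left one) is an instance of the crux. [folklore] -/
theorem isRectilinear_rectQuad : IsRectilinear (rectQuad x₀ x₁ y₀ y₁ hx hy) :=
  isRectilinear_of_carrier_eq hx hy (rectQuad_carrier hx hy)

/-- The marked points of `rectQuad x₀ x₁ y₀ y₁` are its corners `(x₀,y₀), (x₁,y₀), (x₁,y₁), (x₀,y₁)`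
(read off the side descriptions `mem_rectQuad_arc_*` of the tree: `pt k ∈ arc k ∩ arc (k-1)`). [folklore] -/
theorem rectQuad_pt :
    (rectQuad x₀ x₁ y₀ y₁ hx hy).pt 0 = ⟨x₀, y₀⟩ ∧ (rectQuad x₀ x₁ y₀ y₁ hx hy).pt 1 = ⟨x₁, y₀⟩ ∧
      (rectQuad x₀ x₁ y₀ y₁ hx hy).pt 2 = ⟨x₁, y₁⟩ ∧ (rectQuad x₀ x₁ y₀ y₁ hx hy).pt 3 = ⟨x₀, y₁⟩ := by
  set Q := rectQuad x₀ x₁ y₀ y₁ hx hy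
  have a0 : Q.pt 0 ∈ Q.arc 0 := Q.pt_mem_arc_self 0
  have a1 : Q.pt 1 ∈ Q.arc 1 := Q.pt_mem_arc_self 1
  have a2 : Q.pt 2 ∈ Q.arc 2 := Q.pt_mem_arc_self 2
  have a3 : Q.pt 3 ∈ Q.arc 3 := Q.pt_mem_arc_self 3
  have b3 : Q.pt 0 ∈ Q.arc 3 := by simpa using Q.pt_succ_mem_arc 3
  have b0 : Q.pt 1 ∈ Q.arc 0 := by simpa using Q.pt_succ_mem_arc 0
  have b1 : Q.pt 2 ∈ Q.arc 1 := by simpa using Q.pt_succ_mem_arc 1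
  have b2 : Q.pt 3 ∈ Q.arc 2 := by simpa using Q.pt_succ_mem_arc 2
  rw [mem_rectQuad_arc_zero] at a0 b0
  rw [mem_rectQuad_arc_one] at a1 b1
  rw [mem_rectQuad_arc_two] at a2 b2
  rw [mem_rectQuad_arc_three] at a3 b3
  refine ⟨?_, ?_, ?_, ?_⟩ <;> apply Complex.ext <;>
    simp [a0.1, b3.1, a1.1, b0.1, a2.1, b1.1, a3.1, b2.1]

end Rectangles

/-- The square `(-1,1)²` with its corners marked counterclockwise from the bottom-left one
(`unitSquareQuad`, tree) is an instance of the crux. [folklore] -/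
theorem isRectilinear_unitSquareQuad : IsRectilinear unitSquareQuad :=
  isRectilinear_rectQuad _ _

end Summit.CriticalPhenomena.CardyFormulaZ2.Theorems.RectilinearCardy.Negative

end
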